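import Mathlib
import HarnessLib
import Literature.Probability.MarkovChains.MultipleTryIndependenceSamplerSpectrum
import Literature.Probability.MarkovChains.IndependenceSamplerSpectrum
import Literature.Probability.MarkovChains.ISIRUniformErgodicity

/-!
# Yang–Liu, Theorem 2.2 (equality case, finite form): every rejection probability `R(k)` of the
# multiple-try Metropolized independence sampler is an eigenvalue, with Liu's eigenvector `v_k`;
# hence `λ⋆ = 1 − H_k(W)` and `t_rel = 1/H_k(W)` exactly

[cite: YangLiu2021, §2.3 Theorem 2.2 ("`σ(K₀) ⊆ ess-ran(R)` … The equality holds if …"), and the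
remark after it ("As observed in [Liu 1996] in the study of IMH in the discrete state-space case,
in which case `H(w⋆) = 1/w⋆`, `1 − H(w⋆)` should be the convergence rate of the Markov chain")];
[cite: Liu2001MonteCarlo, §13.4 Thm 13.4.1 (Liu's eigenvectors for the independence sampler)]

The MTM-IS(`n+1`) matrix has the same "max-weight" structure as the independence sampler:
off the diagonal `A(i, j) = H(w_i ∨ w_j) p_j` with `H = H_{n+1}` decreasing
(`MultipleTryIndependenceSampler.mtmisKernel_eq`), on the diagonal `H(w_i) p_i + R(i)`.  Therefore
Liu's vectors `v_k = S_p(D) δ_k − p_k 𝟙_D` (`IndependenceSamplerSpectrum.liuVector`, `D` a tail set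
of states lighter than `k`) are right eigenvectors, now with eigenvalue the rejection probability
`R(k)` (the role of Liu's `λ_k = 1 − Σ_j min{q_j, p_j/w_k}` is played by
`R(k) = 1 − Σ_j H(w_k ∨ w_j) p_j`).  With `MultipleTryIndependenceSamplerSpectrum.lean` (every
eigenvalue `≠ 1` is an `R(j)`, all `≤ 1 − H(W)`) and the mode row `R(x⋆) = 1 − H(W)`
(`mtmisKernel_row_mode`), `λ⋆ = 1 − H_{n+1}(W)` exactly.

## Content

* `mtmis_kernel_of_le`, `mtmis_kernel_of_ge`, `mtmis_kernel_self` — the entries.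
* **`mtmis_sum_kernel_mul_liuVector`** — `A v_k = R(k) v_k`;
  `mtmis_hasEigenvector_liuVector`, **`mtmis_hasEigenvalue_stay`** (every `R(k)` with a lighter
  state `j ≠ k` is an eigenvalue).
* **`mtmis_lambdaStar_eq`** — `λ⋆ = 1 − H_{n+1}(W)` for `p ≤ W q` with equality at a mode and at
  least two states; `mtmis_absSpectralGap_eq` (`γ⋆ = H_{n+1}(W)`), **`mtmis_relaxationTime_eq`**
  (`t_rel = 1/H_{n+1}(W)`; one proposal: `t_rel = W`, `IndependenceSamplerSpectrum`).
* `mtmisKernel_zero_eq_imh` — one try: MTM-IS(1) is the IMH kernel of `MetropolisHastings.lean`.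
* `mtmH_le_div` — `H_{n+1}(z) ≤ (n+1)/z`; with `ISIRUniformErgodicity.div_le_mtmH`
  (`(n+1)/(z+n) ≤ H_{n+1}(z)`): **`mtmis_relaxationTime_bounds`** —
  `W/(n+1) ≤ t_rel ≤ (W + n)/(n+1)`: `n + 1` tries divide the relaxation time `W` of the
  independence sampler by a factor between `(n+1)W/(W+n)` and `n + 1`.

NOT CLAIMED: general state spaces; multiplicities.
-/

namespace Literature.Probability.MarkovChains

open Finset

variable {X : Type*} [Fintype X] [DecidableEq X] {p q : X → ℝ} {W : ℝ}

/-- Entry towards a LIGHTER state `j` (`w_j ≤ w_i`, `j ≠ i`): `A(i, j) = H(w_i) p_j`.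
[cite: YangLiu2021, §2.3 Thm 2.1 (`A(x,dy) = π(y) min{H(w(x)), H(w(y))}`)] -/
theorem mtmis_kernel_of_le (hp : ∀ x, 0 < p x) (hq : ∀ x, 0 < q x) (n : ℕ) {i j : X}
    (hij : j ≠ i) (hw : p j / q j ≤ p i / q i) :
    mtmisKernel q p n i j = mtmH q p n (p i / q i) * p j := by
  rw [mtmisKernel_eq hp hq, if_neg hij, add_zero,
    min_eq_left (mtmH_antitone hp hq n (div_pos (hp j) (hq j)) hw)]

/-- Entry towards a HEAVIER state `j` (`w_i ≤ w_j`, `j ≠ i`): `A(i, j) = H(w_j) p_j`.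
[cite: YangLiu2021, §2.3 Thm 2.1] -/
theorem mtmis_kernel_of_ge (hp : ∀ x, 0 < p x) (hq : ∀ x, 0 < q x) (n : ℕ) {i j : X}
    (hij : j ≠ i) (hw : p i / q i ≤ p j / q j) :
    mtmisKernel q p n i j = mtmH q p n (p j / q j) * p j := by
  rw [mtmisKernel_eq hp hq, if_neg hij, add_zero,
    min_eq_right (mtmH_antitone hp hq n (div_pos (hp i) (hq i)) hw)]

/-- Diagonal entry: `A(i, i) = H(w_i) p_i + R(i)`. [cite: YangLiu2021, §2.3 Thm 2.1
(`A(x,dy) = … + R(x) δ_x(dy)`)] -/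
theorem mtmis_kernel_self (hp : ∀ x, 0 < p x) (hq : ∀ x, 0 < q x) (n : ℕ) (i : X) :
    mtmisKernel q p n i i = mtmH q p n (p i / q i) * p i + mtmisStay q p n i := by
  rw [mtmisKernel_eq hp hq, min_self, if_pos rfl]

/-- **Liu's vector is a right eigenvector of MTM-IS with eigenvalue `R(k)`**: for a state `k` and a
tail set `D ∌ k` (`w_j ≤ w_k` on `D`, `w_k ≤ w_j` off `D`), `Σ_j A(i,j) v_k(j) = R(k) v_k(i)` for every
row `i` — rows above `k` pair to `0`, rows of `D` to `−p_k R(k)` (row sums `= 1`), row `k` to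
`S_p(D) R(k)`. [cite: YangLiu2021, §2.3 Theorem 2.2 (equality case)]; the vectors are those of
[cite: Liu2001MonteCarlo, §13.4 Thm 13.4.1] -/
theorem mtmis_sum_kernel_mul_liuVector (hp : ∀ x, 0 < p x) (hq : ∀ x, 0 < q x)
    (hq1 : ∑ x, q x = 1) (n : ℕ) {k : X} {D : Finset X} (hk : k ∉ D)
    (hD : ∀ j ∈ D, p j / q j ≤ p k / q k) (hU : ∀ j ∉ D, p k / q k ≤ p j / q j) (i : X) :
    ∑ j, mtmisKernel q p n i j * liuVector p k D j = mtmisStay q p n k * liuVector p k D i := by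
  have hrow : ∀ x, ∑ j, mtmisKernel q p n x j = 1 := (mtmisKernel_isRowStochastic hp hq hq1 n).2
  -- row `k` on `D`: entries `H(w_k) p_j`
  have hkD : ∑ j ∈ D, mtmisKernel q p n k j = mtmH q p n (p k / q k) * ∑ j ∈ D, p j := by
    rw [mul_sum]
    refine sum_congr rfl fun j hj => ?_
    have hjk : j ≠ k := fun h => hk (h ▸ hj)
    exact mtmis_kernel_of_le hp hq n hjk (hD j hj)
  -- row `k` off `D`: `Σ_{j ∉ D} H(w_j) p_j + R(k)`
  have hkc : ∑ j ∈ Dᶜ, mtmisKernel q p n k j =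
      ∑ j ∈ Dᶜ, mtmH q p n (p j / q j) * p j + mtmisStay q p n k := by
    have hkc' : k ∈ Dᶜ := mem_compl.mpr hk
    rw [← add_sum_erase _ _ hkc', ← add_sum_erase _ (fun j => mtmH q p n (p j / q j) * p j) hkc',
      mtmis_kernel_self hp hq n k]
    have h2 : ∑ j ∈ Dᶜ.erase k, mtmisKernel q p n k j =
        ∑ j ∈ Dᶜ.erase k, mtmH q p n (p j / q j) * p j := by
      refine sum_congr rfl fun j hj => ?_
      have hjk : j ≠ k := ne_of_mem_erase hj
      have hj' : j ∉ D := mem_compl.mp (mem_of_mem_erase hj)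
      exact mtmis_kernel_of_ge hp hq n hjk (hU j hj')
    rw [h2]
    ring
  have hk1 : mtmH q p n (p k / q k) * (∑ j ∈ D, p j) +
      (∑ j ∈ Dᶜ, mtmH q p n (p j / q j) * p j + mtmisStay q p n k) = 1 := by
    rw [← hkD, ← hkc, sum_add_sum_compl, hrow k]
  rw [sum_mul_liuVector]
  by_cases hik : i = k
  · subst hik
    rw [liuVector_apply_self hk, mtmis_kernel_self hp hq n i, hkD]
    ring
  · by_cases hiD : i ∈ D
    · -- a row of the tail: towards `k` the entry is `H(w_k) p_k`; off `D` rows `i` and `k` agree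
      have hwi : p i / q i ≤ p k / q k := hD i hiD
      have h1 : mtmisKernel q p n i k = mtmH q p n (p k / q k) * p k :=
        mtmis_kernel_of_ge hp hq n (Ne.symm hik) hwi
      have hic : ∑ j ∈ Dᶜ, mtmisKernel q p n i j = ∑ j ∈ Dᶜ, mtmH q p n (p j / q j) * p j := by
        refine sum_congr rfl fun j hj => ?_
        have hj' : j ∉ D := mem_compl.mp hj
        have hji : j ≠ i := fun h => hj' (h ▸ hiD)
        exact mtmis_kernel_of_ge hp hq n hji (hwi.trans (hU j hj'))
      have hi1 := hrow i
      rw [← sum_add_sum_compl D, hic] at hi1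
      have hiD' : ∑ j ∈ D, mtmisKernel q p n i j =
          mtmH q p n (p k / q k) * (∑ j ∈ D, p j) + mtmisStay q p n k := by linarith
      rw [liuVector_apply_mem hk hiD, h1, hiD']
      ring
    · -- a row above `k`: every entry towards `D ∪ {k}` is `H(w_i) p_j`
      have hwi : p k / q k ≤ p i / q i := hU i hiD
      have h1 : mtmisKernel q p n i k = mtmH q p n (p i / q i) * p k :=
        mtmis_kernel_of_le hp hq n (Ne.symm hik) hwi
      have h2 : ∑ j ∈ D, mtmisKernel q p n i j = ∑ j ∈ D, mtmH q p n (p i / q i) * p j := by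
        refine sum_congr rfl fun j hj => ?_
        have hji : j ≠ i := fun h => hiD (h ▸ hj)
        exact mtmis_kernel_of_le hp hq n hji ((hD j hj).trans hwi)
      rw [liuVector_apply_of_notMem hiD hik, h1, h2, ← mul_sum]
      ring

/-- **`v_k` is an eigenvector of MTM-IS** (Mathlib's `Module.End.HasEigenvector` of the
complexified matrix) for the eigenvalue `R(k)`, as soon as the tail set is non-empty.
[cite: YangLiu2021, §2.3 Theorem 2.2 (equality case)]; [cite: Liu2001MonteCarlo, §13.4
Thm 13.4.1] -/
theorem mtmis_hasEigenvector_liuVector (hp : ∀ x, 0 < p x) (hq : ∀ x, 0 < q x)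
    (hq1 : ∑ x, q x = 1) (n : ℕ) {k : X} {D : Finset X} (hk : k ∉ D)
    (hD : ∀ j ∈ D, p j / q j ≤ p k / q k) (hU : ∀ j ∉ D, p k / q k ≤ p j / q j)
    (hne : D.Nonempty) :
    Module.End.HasEigenvector
      (Matrix.toLin' fun x y => (mtmisKernel q p n x y : ℂ))
      (mtmisStay q p n k : ℂ) (fun x => (liuVector p k D x : ℂ)) := by
  rw [hasEigenvector_iff]
  refine ⟨fun h => ?_, fun x => ?_⟩
  · have h1 := congrFun h k
    simp only [Pi.zero_apply, Complex.ofReal_eq_zero, liuVector_apply_self hk] at h1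
    have : 0 < ∑ i ∈ D, p i := sum_pos (fun i _ => hp i) hne
    linarith
  · exact_mod_cast mtmis_sum_kernel_mul_liuVector hp hq hq1 n hk hD hU x

/-- **Every rejection probability `R(k)` is an eigenvalue of MTM-IS** for every state `k` admitting
another state `j ≠ k` with `w_j ≤ w_k` (tail set `{j ≠ k : w_j ≤ w_k}`).
[cite: YangLiu2021, §2.3 Theorem 2.2 (equality case of `σ(K₀) ⊆ ess-ran(R)`)] -/
theorem mtmis_hasEigenvalue_stay (hp : ∀ x, 0 < p x) (hq : ∀ x, 0 < q x) (hq1 : ∑ x, q x = 1)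
    (n : ℕ) {k j : X} (hjk : j ≠ k) (hw : p j / q j ≤ p k / q k) :
    Module.End.HasEigenvalue
      (Matrix.toLin' fun x y => (mtmisKernel q p n x y : ℂ)) (mtmisStay q p n k : ℂ) := by
  set D : Finset X := univ.filter fun i => i ≠ k ∧ p i / q i ≤ p k / q k with hDdef
  have hk : k ∉ D := by simp [hDdef]
  have hD : ∀ i ∈ D, p i / q i ≤ p k / q k := fun i hi => (mem_filter.mp hi).2.2
  have hU : ∀ i ∉ D, p k / q k ≤ p i / q i := by
    intro i hi
    by_cases hik : i = k
    · rw [hik]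
    · have : ¬(p i / q i ≤ p k / q k) := fun h => hi (mem_filter.mpr ⟨mem_univ i, hik, h⟩)
      exact (not_le.mp this).le
  have hjD : j ∈ D := mem_filter.mpr ⟨mem_univ j, hjk, hw⟩
  exact Module.End.hasEigenvalue_of_hasEigenvector
    (mtmis_hasEigenvector_liuVector hp hq hq1 n hk hD hU ⟨j, hjD⟩)

/-! ## `λ⋆ = 1 − H_k(W)` and `t_rel = 1/H_k(W)` -/

/-- At a mode `x⋆` (`p x⋆ = W q x⋆` with `p ≤ W q`) the rejection probability is
`R(x⋆) = 1 − H_{n+1}(W)`. [cite: YangLiu2021, §3.2 (proof of Thm 3.1, lower bound: the row at `x⋆`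
is `(1 − H(w⋆)) δ_{x⋆} + H(w⋆) π`)] -/
theorem mtmisStay_mode (hp : ∀ x, 0 < p x) (hp1 : ∑ x, p x = 1) (hq : ∀ x, 0 < q x)
    (hq1 : ∑ x, q x = 1) (n : ℕ) (hW : ∀ x, p x ≤ W * q x) {xs : X} (hxs : p xs = W * q xs) :
    mtmisStay q p n xs = 1 - mtmH q p n W := by
  have hrow := sum_mtmisMove_add_mtmisStay hp hq hq1 n xs
  simp_rw [mtmisMove_mode hp hq n hW hxs] at hrow
  rw [← mul_sum, hp1, mul_one] at hrow
  linarith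

/-- **`λ⋆` of MTM-IS(`n+1`) is exactly `1 − H_{n+1}(W)`**: for `p ≤ W q` with equality at a mode
`x⋆` and at least two states, `max {|λ| : λ ≠ 1 an eigenvalue} = 1 − H_{n+1}(W) = R(x⋆)`.
[cite: YangLiu2021, §2.3 Theorem 2.2 and the remark after it ("`1 − H(w⋆)` should be the
convergence rate")]; `λ⋆` of [cite: LevinPeres2017, §12.2 eq. (12.6)] -/
theorem mtmis_lambdaStar_eq (hp : ∀ x, 0 < p x) (hp1 : ∑ x, p x = 1) (hq : ∀ x, 0 < q x)
    (hq1 : ∑ x, q x = 1) (n : ℕ) (hW : ∀ x, p x ≤ W * q x) {xs : X} (hxs : p xs = W * q xs)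
    (hX : ∃ y, y ≠ xs) :
    lambdaStar (mtmisKernel q p n) = 1 - mtmH q p n W := by
  obtain ⟨y, hy⟩ := hX
  haveI : Nonempty X := ⟨xs⟩
  have hW0 : 0 < W := pos_of_mul_pos_left ((hp xs).trans_le (hW xs)) (hq xs).le
  have hwxs : p xs / q xs = W := by rw [hxs, mul_div_assoc, div_self (hq xs).ne', mul_one]
  have hwy : p y / q y ≤ p xs / q xs := by rw [hwxs, div_le_iff₀ (hq y)]; exact hW y
  have hmode : mtmisStay q p n xs = 1 - mtmH q p n W := mtmisStay_mode hp hp1 hq hq1 n hW hxs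
  have hne1 : (mtmisStay q p n xs : ℂ) ≠ 1 := by
    have : mtmisStay q p n xs < 1 := by
      rw [hmode]; linarith [mtmH_pos hp hq n hW0]
    exact_mod_cast this.ne
  have hev : (mtmisStay q p n xs : ℂ) ∈ nontrivialEigenvalues (mtmisKernel q p n) :=
    ⟨mtmis_hasEigenvalue_stay hp hq hq1 n hy hwy, hne1⟩
  apply le_antisymm (mtmis_lambdaStar_le hp hp1 hq hq1 n hW)
  calc 1 - mtmH q p n W = ‖(mtmisStay q p n xs : ℂ)‖ := by
        rw [Complex.norm_real, Real.norm_of_nonneg (mtmisStay_nonneg hp hq n xs), hmode]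
    _ ≤ lambdaStar _ := norm_le_lambdaStar hev

/-- **`γ⋆ = H_{n+1}(W)`** for MTM-IS under the hypotheses of `mtmis_lambdaStar_eq`.
[cite: YangLiu2021, §2.3 Theorem 2.2, §3.1]; `γ⋆` of [cite: LevinPeres2017, §12.2] -/
theorem mtmis_absSpectralGap_eq (hp : ∀ x, 0 < p x) (hp1 : ∑ x, p x = 1) (hq : ∀ x, 0 < q x)
    (hq1 : ∑ x, q x = 1) (n : ℕ) (hW : ∀ x, p x ≤ W * q x) {xs : X} (hxs : p xs = W * q xs)
    (hX : ∃ y, y ≠ xs) :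
    absSpectralGap (mtmisKernel q p n) = mtmH q p n W := by
  unfold absSpectralGap
  rw [mtmis_lambdaStar_eq hp hp1 hq hq1 n hW hxs hX]
  ring

/-- **`t_rel = 1/H_{n+1}(W)`** for MTM-IS(`n+1`) — the multiple-try analogue of `t_rel = W` for
the one-proposal independence sampler (`IndependenceSamplerSpectrum.imh_relaxationTime_eq`; indeed
`H_1(z) = 1/z`). [cite: YangLiu2021, §2.3 Theorem 2.2 and the remark after it, §3.1];
`t_rel` of [cite: LevinPeres2017, §12.2] -/
theorem mtmis_relaxationTime_eq (hp : ∀ x, 0 < p x) (hp1 : ∑ x, p x = 1) (hq : ∀ x, 0 < q x)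
    (hq1 : ∑ x, q x = 1) (n : ℕ) (hW : ∀ x, p x ≤ W * q x) {xs : X} (hxs : p xs = W * q xs)
    (hX : ∃ y, y ≠ xs) :
    relaxationTime (mtmisKernel q p n) = 1 / mtmH q p n W := by
  unfold relaxationTime
  rw [mtmis_absSpectralGap_eq hp hp1 hq hq1 n hW hxs hX]


omit [DecidableEq X] in
/-- `H_{n+1}(z) ≤ (n+1)/z` for `z > 0` (drop the non-negative pool weight in the denominator).
[cite: YangLiu2021, §3.3 Theorem 3.2 (its consequence `H_k(w) ≤ 1 − (1 − 1/w)^k ≤ k/w`)];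
cf. [cite: PozzaZanella2025, §3.1 Corollary 1] -/
theorem mtmH_le_div (hp : ∀ x, 0 < p x) (hq : ∀ x, 0 < q x) (hq1 : ∑ x, q x = 1) (n : ℕ)
    {z : ℝ} (hz : 0 < z) : mtmH q p n z ≤ (n + 1) / z := by
  unfold mtmH
  rw [div_eq_mul_one_div ((n : ℝ) + 1)]
  refine mul_le_mul_of_nonneg_left ?_ (by positivity)
  calc ∑ r : Fin n → X, trialProb q r / (z + weightSum q p r)
      ≤ ∑ r : Fin n → X, trialProb q r / z := by
        refine sum_le_sum fun r _ => div_le_div_of_nonneg_left ?_ hz ?_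
        · unfold trialProb; exact prod_nonneg fun i _ => (hq _).le
        · have : 0 ≤ weightSum q p r := by
            unfold weightSum; exact sum_nonneg fun i _ => (div_pos (hp _) (hq _)).le
          linarith
    _ = 1 / z := by rw [← sum_div, sum_trialProb hq1 n]

/-- **Two-sided relaxation-time bound for MTM-IS(`n+1`)**: `W/(n+1) ≤ t_rel ≤ (W + n)/(n+1)`
(`p ≤ W q` with equality at a mode, at least two states) — from `t_rel = 1/H_{n+1}(W)` and
`(n+1)/(W+n) ≤ H_{n+1}(W) ≤ (n+1)/W`. [cite: YangLiu2021, §2.3 Theorem 2.2, §3.3 Theorem 3.2];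
[cite: AndrieuLeeVihola2018, §4 (the Jensen step)] -/
theorem mtmis_relaxationTime_bounds (hp : ∀ x, 0 < p x) (hp1 : ∑ x, p x = 1) (hq : ∀ x, 0 < q x)
    (hq1 : ∑ x, q x = 1) (n : ℕ) (hW : ∀ x, p x ≤ W * q x) {xs : X} (hxs : p xs = W * q xs)
    (hX : ∃ y, y ≠ xs) :
    W / (n + 1) ≤ relaxationTime (mtmisKernel q p n) ∧
      relaxationTime (mtmisKernel q p n) ≤ (W + n) / (n + 1) := by
  haveI : Nonempty X := ⟨xs⟩
  have hW0 : 0 < W := pos_of_mul_pos_left ((hp xs).trans_le (hW xs)) (hq xs).le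
  have hH : 0 < mtmH q p n W := mtmH_pos hp hq n hW0
  rw [mtmis_relaxationTime_eq hp hp1 hq hq1 n hW hxs hX]
  constructor
  · -- `W/(n+1) = 1/((n+1)/W) ≤ 1/H`
    rw [show W / ((n : ℝ) + 1) = 1 / ((n + 1) / W) by rw [one_div_div]]
    exact one_div_le_one_div_of_le hH (mtmH_le_div hp hq hq1 n hW0)
  · rw [show (W + n) / ((n : ℝ) + 1) = 1 / ((n + 1) / (W + n)) by rw [one_div_div]]
    exact one_div_le_one_div_of_le (by positivity) (div_le_mtmH hp hp1 hq hq1 n hW0)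


/-! ## One try: MTM-IS(1) is the Metropolized independence sampler -/

/-- **`k = 1`: MTM-IS(1) = IMH** — with one proposal the multiple-try kernel is the
independence-sampler kernel of `MetropolisHastings.lean` (`H_1(z) = 1/z`), so
`IndependenceSamplerSpectrum` is the case `n = 0` of this file. [cite: YangLiu2021, §2.3 ("Note that
`H_1(z) = z⁻¹`")]; [cite: Liu2001MonteCarlo, §5.5.1 (MTMIS), §5.4.2 (MIS)] -/
theorem mtmisKernel_zero_eq_imh (hp : ∀ x, 0 < p x) (hq : ∀ x, 0 < q x) (hq1 : ∑ x, q x = 1) :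
    mtmisKernel q p 0 = mhKernel (fun _ z => q z) p := by
  have hoff : ∀ x y, y ≠ x → mtmisKernel q p 0 x y = mhKernel (fun _ z => q z) p x y := by
    intro x y hyx
    have hpx : p x ≠ 0 := (hp x).ne'
    have hqx : q x ≠ 0 := (hq x).ne'
    have hpy : p y ≠ 0 := (hp y).ne'
    have hqy : q y ≠ 0 := (hq y).ne'
    rw [mtmisKernel_eq hp hq, if_neg hyx, add_zero, mtmH_zero, mtmH_zero, mhKernel_of_ne hyx]
    unfold mhRate
    rw [min_mul_of_nonneg _ _ (hp y).le, min_comm]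
    congr 1
    · field_simp
    · field_simp
  funext x y
  by_cases hyx : y = x
  · subst hyx
    have h1 := (mtmisKernel_isRowStochastic hp hq hq1 0).2 y
    have h2 := (mhKernel_isRowStochastic (fun _ z => (hq z).le) (fun _ => hq1.le) hp).2 y
    rw [← Finset.add_sum_erase _ _ (mem_univ y)] at h1 h2
    have h3 : ∑ z ∈ univ.erase y, mtmisKernel q p 0 y z =
        ∑ z ∈ univ.erase y, mhKernel (fun _ z => q z) p y z :=
      sum_congr rfl fun z hz => hoff y z (ne_of_mem_erase hz)
    linarith
  · exact hoff x y hyx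

end Literature.Probability.MarkovChains
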